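import Summits.NavierStokesRegularity.NavierStokesRegularity.Theorems.PoloidalWindowDoorPoloidalWindowRigidityZShockPSystemLiouvilleAlong
import Summits.NavierStokesRegularity.NavierStokesRegularity.Theorems.PoloidalWindowDoorPoloidalWindowRigidityZShockRiccatiDivergent
import HarnessLib

/-!
# Crux K2 `PoloidalWindowRigidity` (stmt-NavierStokesRegularity-19708), line `z_shock` — RUNG R2 UNDER NON-UNIFORM GENUINE
# NONLINEARITY: the two-sided p-system Liouville theorem with `κ'(w) ≥ 0` and DIVERGENT accumulated nonlinearity along characteristics

`--supports stmt-NavierStokesRegularity-19708 --as helper` (leafhand-ns-poloidalwindowdoor-3 g2, cell decomp-ns, 2026-08-31).  Class-free,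
Mathlib + tree files only.  **No stub and no summit is closed by this file; Navier–Stokes regularity is NOT proved here (rung 0).**

WHY THIS FILE.  The tree's rung R2 (`…ZShockPSystemLiouvilleAlong.pSystem_const_along`, p-system `p_z = −κ(w)² w_x`, `w_z = −p_x`,
two-sided in the height `z`) assumes UNIFORM genuine nonlinearity `κ'(w q) ≥ k₀ > 0` along the solution.  What the class supplies at the
densely hyperbolic time is only `κ' ≥ 0` with isolated sonic values and genuine nonlinearity at SOME attained value
(`…ZShockSonicValues.gn_or_globalTH_of_class`); the standing repair census (leaf hands 3-g0/3-g1) therefore asks for «R2 with NON-uniform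
genuine nonlinearity».  `…ZShockRiccatiDivergent` (p822599) settled the ODE level: the Lax–John kernel needs exactly the two-sided
DIVERGENCE of the accumulated coefficient, and strict positivity at every height is NOT enough (`riccati_twoSided_integrable_witness`).
This file lifts that to the p-system:

* `dampedRiccati_twoSided_eq_zero_of_minorant` — John's damped law `α' = −aα² − h'α` with `a ≥ ã ≥ 0`, `|h| ≤ H` and an antiderivative
  of the minorant `ã` unbounded above and below ⇒ `α ≡ 0`;
* `transversal_eq_zero_of_split_divergent` — the family lemma of `…ZShockPSystemLiouville` (`transversal_eq_zero_of_split`) with the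
  uniform bound `a ≥ a₀ > 0` replaced by the divergence hypothesis;
* `pSystem_derivs_eq_zero_of_divergent`, `pSystem_const_of_divergent` — ★ R2, NON-UNIFORM FORM: a two-sided eternal `C²` solution with
  `w_x` bounded, `0 < κlo ≤ κ(w) ≤ κhi`, `|κ'(w)| ≤ k₁`, `κ'(w) ≥ 0` along the solution, such that ALONG EVERY global `±κ(w)`-characteristic
  `X` the accumulated genuine nonlinearity `∫ κ'(w(z, X z)) dz` DIVERGES in both height directions (stated: some antiderivative is unbounded
  above and below), is a constant state.  The uniform case is the special case `A(z) = ∫₀^z κ'(w) ≥ k₀ z`-growth; the new theorem also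
  covers slope functions whose genuine nonlinearity degenerates at isolated values PROVIDED no characteristic settles down onto a
  degenerate value fast enough to make `∫ κ'(w)` converge — and `…RiccatiDivergent.riccati_twoSided_integrable_witness` shows that without
  such a proviso the characteristic ODE has bounded eternal non-trivial solutions.  So the residual content of the non-uniform 1-D shadow is
  exactly a RECURRENCE statement for the values of `w` along characteristics (recorded for the planner; not claimed).

[folklore] (Lax 1964 (2.6); John 1974 §2; Klainerman–Majda 1980 for the degenerate string; the card `Lines/z_shock.md` §R2)
-/

noncomputable section

namespace Summit.NavierStokesRegularity.NavierStokesRegularity.Theorems.PoloidalWindowDoorPoloidalWindowRigidityZShockPSystemLiouvilleDivergent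

-- the summit and its single sub-problem share the name (CONVENTIONS §1)
set_option linter.dupNamespace false

open Set Filter Topology Function Metric
open scoped NNReal
open Summit.NavierStokesRegularity.NavierStokesRegularity.Theorems.PoloidalWindowDoorPoloidalWindowRigidityZShockRiccatiTwoSided
open Summit.NavierStokesRegularity.NavierStokesRegularity.Theorems.PoloidalWindowDoorPoloidalWindowRigidityZShockRiccatiDivergent
open Summit.NavierStokesRegularity.NavierStokesRegularity.Theorems.PoloidalWindowDoorPoloidalWindowRigidityZShockCharacteristicRiccati
open Summit.NavierStokesRegularity.NavierStokesRegularity.Theorems.PoloidalWindowDoorPoloidalWindowRigidityZShockGlobalCharacteristics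
open Summit.NavierStokesRegularity.NavierStokesRegularity.Theorems.PoloidalWindowDoorPoloidalWindowRigidityZShockPSystemLiouville

/-! ## The damped kernel with a divergent minorant -/

/-- **John's damped law with a divergent minorant.**  If `α' = −a·α² − h'·α` on `ℝ` with `a ≥ ã ≥ 0`, `|h| ≤ H` (`h' =` the derivative
of `h`) and some antiderivative `A` of `ã` is unbounded above and below, then `α ≡ 0` (`q := e^{h}α` obeys `q' = −(a e^{−h}) q²` with
`a e^{−h} ≥ e^{−H} ã`, whose antiderivative `e^{−H} A` is unbounded both ways; `riccati_twoSided_eq_zero_of_unbounded`). [folklore] -/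
theorem dampedRiccati_twoSided_eq_zero_of_minorant {α a ã h h' A : ℝ → ℝ} {H : ℝ} (hã : ∀ z, 0 ≤ ã z) (hãa : ∀ z, ã z ≤ a z)
    (hH : ∀ z, |h z| ≤ H) (hh : ∀ z, HasDerivAt h (h' z) z) (hA : ∀ z, HasDerivAt A (ã z) z)
    (hup : ∀ K : ℝ, ∃ z, K < A z) (hdown : ∀ K : ℝ, ∃ z, A z < K)
    (hα : ∀ z, HasDerivAt α (-(a z * α z ^ 2) - h' z * α z) z) : ∀ z, α z = 0 := by
  have ha : ∀ z, 0 ≤ a z := fun z => (hã z).trans (hãa z)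
  set q : ℝ → ℝ := fun z => Real.exp (h z) * α z with hq
  have hqd : ∀ z, HasDerivAt q (-(a z * Real.exp (-h z) * q z ^ 2)) z := by
    intro z
    have he : HasDerivAt (fun y => Real.exp (h y)) (Real.exp (h z) * h' z) z := (hh z).exp
    have hprod := he.mul (hα z)
    refine hprod.congr_deriv ?_
    have hexp : Real.exp (-h z) * Real.exp (h z) = 1 := by rw [← Real.exp_add]; simp
    simp only [hq]
    have : a z * Real.exp (-h z) * (Real.exp (h z) * α z) ^ 2 =
        a z * α z ^ 2 * Real.exp (h z) * (Real.exp (-h z) * Real.exp (h z)) := by ring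
    rw [this, hexp]
    ring
  have hβ : ∀ z, 0 ≤ Real.exp (-H) * ã z := fun z => mul_nonneg (Real.exp_pos _).le (hã z)
  have hβb : ∀ z, Real.exp (-H) * ã z ≤ a z * Real.exp (-h z) := by
    intro z
    have h1 : Real.exp (-H) ≤ Real.exp (-h z) := Real.exp_le_exp.2 (by linarith [hH z, le_abs_self (h z)])
    calc Real.exp (-H) * ã z ≤ Real.exp (-H) * a z := mul_le_mul_of_nonneg_left (hãa z) (Real.exp_pos _).le
      _ ≤ Real.exp (-h z) * a z := mul_le_mul_of_nonneg_right h1 (ha z)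
      _ = a z * Real.exp (-h z) := mul_comm _ _
  have hB : ∀ z, HasDerivAt (fun z => Real.exp (-H) * A z) (Real.exp (-H) * ã z) z :=
    fun z => (hA z).const_mul _
  have hE : 0 < Real.exp (-H) := Real.exp_pos _
  have hup' : ∀ K : ℝ, ∃ z, K < Real.exp (-H) * A z := by
    intro K
    obtain ⟨z, hz⟩ := hup (K / Real.exp (-H))
    exact ⟨z, by rwa [div_lt_iff₀ hE, mul_comm] at hz⟩
  have hdown' : ∀ K : ℝ, ∃ z, Real.exp (-H) * A z < K := by
    intro K
    obtain ⟨z, hz⟩ := hdown (K / Real.exp (-H))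
    exact ⟨z, by rwa [lt_div_iff₀ hE, mul_comm] at hz⟩
  have hq0 := riccati_twoSided_eq_zero_of_unbounded (b := fun z => a z * Real.exp (-h z)) hβ hβb hB hup' hdown' hqd
  intro z
  have hz := hq0 z
  simp only [hq, mul_eq_zero, Real.exp_ne_zero, false_or] at hz
  exact hz

/-- **Family lemma, divergent form.**  As `…ZShockPSystemLiouville.transversal_eq_zero_of_split` (transport equation
`r_z + c r_x = 0`, a global `c`-characteristic `X`, the split `c_x r_x = a r_x² + h' r_x` along it with John's bounded weight `h`), with
the uniform bound `a ≥ a₀ > 0` replaced by `a ≥ ã ≥ 0` and an antiderivative of `ã` along the curve unbounded above and below: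
`r_x ≡ 0` along `X`. [folklore] -/
theorem transversal_eq_zero_of_split_divergent {r c : ℝ × ℝ → ℝ} (hr : ContDiff ℝ 2 r) (hc : Differentiable ℝ c)
    (hPDE : ∀ q, fderiv ℝ r q (1, 0) + c q * fderiv ℝ r q (0, 1) = 0)
    {X : ℝ → ℝ} (hX : ∀ z, HasDerivAt X (c (z, X z)) z)
    {a ã h h' A : ℝ → ℝ} {H : ℝ} (hã : ∀ z, 0 ≤ ã z) (hãa : ∀ z, ã z ≤ a z) (hH : ∀ z, |h z| ≤ H)
    (hh : ∀ z, HasDerivAt h (h' z) z) (hA : ∀ z, HasDerivAt A (ã z) z)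
    (hup : ∀ K : ℝ, ∃ z, K < A z) (hdown : ∀ K : ℝ, ∃ z, A z < K)
    (hsplit : ∀ z, fderiv ℝ c (z, X z) (0, 1) * fderiv ℝ r (z, X z) (0, 1) =
      a z * fderiv ℝ r (z, X z) (0, 1) ^ 2 + h' z * fderiv ℝ r (z, X z) (0, 1)) :
    ∀ z, fderiv ℝ r (z, X z) (0, 1) = 0 := by
  refine dampedRiccati_twoSided_eq_zero_of_minorant (α := fun t => fderiv ℝ r (t, X t) (0, 1)) hã hãa hH hh hA hup hdown
    fun z => ?_
  have hL := transversal_deriv_along_of_speed hr hc hPDE hX z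
  refine hL.congr_deriv ?_
  rw [hsplit z]; ring

/-! ## The p-system under non-uniform genuine nonlinearity -/

/-- **★ R2, non-uniform form: all first derivatives vanish.**  Let `w, p ∈ C²(ℝ × ℝ)` solve the autonomous p-system
`p_z = −κ(w)² w_x`, `w_z = −p_x` on the whole plane (`z` = first coordinate, two-sided), with `w_x` bounded, `K' = κ`, `κ'` the
derivative of `κ`, `0 < κlo ≤ κ(w q) ≤ κhi`, `|κ'(w q)| ≤ k₁` and NON-UNIFORM genuine nonlinearity `κ'(w q) ≥ 0` at every point `q`.
Assume the DIVERGENCE HYPOTHESIS: along every global characteristic `X` of either family (`X' = ±κ(w(z, X z))`) some antiderivative of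
`z ↦ κ'(w(z, X z))` is unbounded above and below.  Then `w_x = p_x = w_z = p_z = 0` everywhere.  Proof: that of
`pSystem_derivs_eq_zero_along` verbatim, with `transversal_eq_zero_of_split_divergent` (minorant `κ'(w)/(2κhi) ≤ κ'(w)/(2κ(w))`,
antiderivative `A/(2κhi)`) in place of the uniform family lemma. [folklore] -/
theorem pSystem_derivs_eq_zero_of_divergent {w p : ℝ × ℝ → ℝ} {κ κ' K : ℝ → ℝ} (hw : ContDiff ℝ 2 w) (hp : ContDiff ℝ 2 p)
    (hK2 : ContDiff ℝ 2 K) (hKd : ∀ v, HasDerivAt K (κ v) v) (hκd : ∀ v, HasDerivAt κ (κ' v) v)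
    (hsys1 : ∀ q, fderiv ℝ p q (1, 0) = -(κ (w q) ^ 2 * fderiv ℝ w q (0, 1)))
    (hsys2 : ∀ q, fderiv ℝ w q (1, 0) = -fderiv ℝ p q (0, 1))
    {κlo κhi k₁ W₁ : ℝ} (hκlo0 : 0 < κlo) (hκlo : ∀ q, κlo ≤ κ (w q)) (hκhi : ∀ q, κ (w q) ≤ κhi)
    (hgnl : ∀ q, 0 ≤ κ' (w q)) (hk₁ : ∀ q, |κ' (w q)| ≤ k₁) (hW₁ : ∀ q, |fderiv ℝ w q (0, 1)| ≤ W₁)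
    (hdiv : ∀ σ : ℝ, (σ = 1 ∨ σ = -1) → ∀ X : ℝ → ℝ, (∀ z, HasDerivAt X (σ * κ (w (z, X z))) z) →
      ∃ A : ℝ → ℝ, (∀ z, HasDerivAt A (κ' (w (z, X z))) z) ∧ (∀ M : ℝ, ∃ z, M < A z) ∧ (∀ M : ℝ, ∃ z, A z < M)) :
    ∀ q : ℝ × ℝ, fderiv ℝ w q (0, 1) = 0 ∧ fderiv ℝ p q (0, 1) = 0 ∧
      fderiv ℝ w q (1, 0) = 0 ∧ fderiv ℝ p q (1, 0) = 0 := by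
  -- adapted from …ZShockPSystemLiouvilleAlong.pSystem_derivs_eq_zero_along (uniform case)
  have hw1 : Differentiable ℝ w := hw.differentiable (by simp)
  have hp1 : Differentiable ℝ p := hp.differentiable (by simp)
  have hκ1 : Differentiable ℝ κ := fun v => (hκd v).differentiableAt
  have hκpos : ∀ q, 0 < κ (w q) := fun q => hκlo0.trans_le (hκlo q)
  have hκhi0 : 0 < κhi := hκlo0.trans_le ((hκlo 0).trans (hκhi 0))
  -- Riemann invariants
  set r : ℝ × ℝ → ℝ := fun q => p q + K (w q) with hrdef
  set s : ℝ × ℝ → ℝ := fun q => p q - K (w q) with hsdef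
  have hr2 : ContDiff ℝ 2 r := hp.add (hK2.comp hw)
  have hs2 : ContDiff ℝ 2 s := hp.sub (hK2.comp hw)
  have hKw : ∀ q, HasFDerivAt (fun q' => K (w q')) (κ (w q) • fderiv ℝ w q) q :=
    fun q => (hKd (w q)).comp_hasFDerivAt q (hw1 q).hasFDerivAt
  have hrF : ∀ q, HasFDerivAt r (fderiv ℝ p q + κ (w q) • fderiv ℝ w q) q :=
    fun q => (hp1 q).hasFDerivAt.add (hKw q)
  have hsF : ∀ q, HasFDerivAt s (fderiv ℝ p q - κ (w q) • fderiv ℝ w q) q :=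
    fun q => (hp1 q).hasFDerivAt.sub (hKw q)
  have hrD : ∀ q v, fderiv ℝ r q v = fderiv ℝ p q v + κ (w q) * fderiv ℝ w q v := by
    intro q v
    rw [(hrF q).fderiv]
    simp [smul_eq_mul]
  have hsD : ∀ q v, fderiv ℝ s q v = fderiv ℝ p q v - κ (w q) * fderiv ℝ w q v := by
    intro q v
    rw [(hsF q).fderiv]
    simp [smul_eq_mul]
  -- the two speeds and the diagonal equations
  set c₁ : ℝ × ℝ → ℝ := fun q => κ (w q) with hc₁
  set c₂ : ℝ × ℝ → ℝ := fun q => -κ (w q) with hc₂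
  have hκw : ∀ q, HasFDerivAt (fun q' => κ (w q')) (κ' (w q) • fderiv ℝ w q) q :=
    fun q => (hκd (w q)).comp_hasFDerivAt q (hw1 q).hasFDerivAt
  have hc₁d : Differentiable ℝ c₁ := fun q => (hκw q).differentiableAt
  have hc₂d : Differentiable ℝ c₂ := fun q => (hκw q).neg.differentiableAt
  have hc₁x : ∀ q, fderiv ℝ c₁ q (0, 1) = κ' (w q) * fderiv ℝ w q (0, 1) := by
    intro q; rw [hc₁, (hκw q).fderiv]; simp [smul_eq_mul]
  have hc₂F : ∀ q, HasFDerivAt c₂ (-(κ' (w q) • fderiv ℝ w q)) q := fun q => (hκw q).neg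
  have hc₂x : ∀ q, fderiv ℝ c₂ q (0, 1) = -(κ' (w q) * fderiv ℝ w q (0, 1)) := by
    intro q; rw [(hc₂F q).fderiv]; simp [smul_eq_mul]
  have hPDE1 : ∀ q, fderiv ℝ r q (1, 0) + c₁ q * fderiv ℝ r q (0, 1) = 0 := by
    intro q; rw [hrD, hrD, hc₁, hsys1, hsys2]; ring
  have hPDE2 : ∀ q, fderiv ℝ s q (1, 0) + c₂ q * fderiv ℝ s q (0, 1) = 0 := by
    intro q; rw [hsD, hsD, hc₂, hsys1, hsys2]; ring
  -- global characteristics for both speeds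
  have hW₁0 : 0 ≤ W₁ := (abs_nonneg _).trans (hW₁ 0)
  have hk₁0 : 0 ≤ k₁ := (abs_nonneg _).trans (hk₁ 0)
  have hchar : ∀ σ : ℝ, (σ = 1 ∨ σ = -1) → ∀ z₀ x₀ : ℝ, ∃ X : ℝ → ℝ, X z₀ = x₀ ∧
      ∀ z, HasDerivAt X (σ * κ (w (z, X z))) z := by
    intro σ hσ z₀ x₀
    have hσ1 : |σ| = 1 := by rcases hσ with h | h <;> simp [h]
    have hsl : ∀ z x, HasDerivAt (fun x' => σ * κ (w (z, x'))) (σ * (κ' (w (z, x)) * fderiv ℝ w (z, x) (0, 1))) x := by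
      intro z x
      have hγ : HasDerivAt (fun x' : ℝ => ((z, x') : ℝ × ℝ)) ((0 : ℝ), (1 : ℝ)) x :=
        (hasDerivAt_const x z).prodMk (hasDerivAt_id x)
      have h1 : HasDerivAt (fun x' => κ (w (z, x'))) ((κ' (w (z, x)) • fderiv ℝ w (z, x)) ((0 : ℝ), (1 : ℝ))) x :=
        (hκw (z, x)).comp_hasDerivAt x hγ
      have h2 := h1.const_mul σ
      simpa [smul_eq_mul] using h2
    refine exists_global_solution (F := fun z x => σ * κ (w (z, x))) (K := Real.toNNReal (k₁ * W₁))
      (B := Real.toNNReal κhi) (fun z => ?_) (fun x => ?_) (fun z x => ?_) z₀ x₀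
    · refine lipschitzWith_of_nnnorm_deriv_le (fun x => (hsl z x).differentiableAt) fun x => ?_
      rw [(hsl z x).deriv, ← NNReal.coe_le_coe, coe_nnnorm, Real.coe_toNNReal _ (mul_nonneg hk₁0 hW₁0),
        Real.norm_eq_abs, abs_mul, hσ1, one_mul, abs_mul]
      exact mul_le_mul (hk₁ _) (hW₁ _) (abs_nonneg _) hk₁0
    · exact continuous_const.mul (hκ1.continuous.comp (hw1.continuous.comp (continuous_id.prodMk continuous_const)))
    · rw [Real.norm_eq_abs, abs_mul, hσ1, one_mul, abs_of_pos (hκpos _), Real.coe_toNNReal _ hκhi0.le]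
      exact hκhi _
  -- John's weight `h = ½ log κ(w)` along a curve, and the bounds
  set H : ℝ := (|Real.log κlo| + |Real.log κhi|) / 2 with hHdef
  have hlogbd : ∀ q, |Real.log (κ (w q)) / 2| ≤ H := by
    intro q
    have h1 : Real.log κlo ≤ Real.log (κ (w q)) := Real.log_le_log hκlo0 (hκlo q)
    have h2 : Real.log (κ (w q)) ≤ Real.log κhi := Real.log_le_log (hκpos q) (hκhi q)
    rw [abs_div, abs_two, hHdef]
    have : |Real.log (κ (w q))| ≤ |Real.log κlo| + |Real.log κhi| := by
      rcases le_total 0 (Real.log (κ (w q))) with h0 | h0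
      · rw [abs_of_nonneg h0]; linarith [le_abs_self (Real.log κhi), abs_nonneg (Real.log κlo)]
      · rw [abs_of_nonpos h0]; linarith [neg_abs_le (Real.log κlo), abs_nonneg (Real.log κhi)]
    linarith
  -- the divergent minorant `κ'(w)/(2κhi) ≤ κ'(w)/(2κ(w))` along a `σκ`-characteristic
  have hminor : ∀ (σ : ℝ), (σ = 1 ∨ σ = -1) → ∀ (X : ℝ → ℝ), (∀ z, HasDerivAt X (σ * κ (w (z, X z))) z) →
      ∃ A : ℝ → ℝ, (∀ z, 0 ≤ κ' (w (z, X z)) / (2 * κhi)) ∧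
        (∀ z, κ' (w (z, X z)) / (2 * κhi) ≤ κ' (w (z, X z)) / (2 * κ (w (z, X z)))) ∧
        (∀ z, HasDerivAt A (κ' (w (z, X z)) / (2 * κhi)) z) ∧ (∀ M : ℝ, ∃ z, M < A z) ∧ (∀ M : ℝ, ∃ z, A z < M) := by
    intro σ hσ X hX
    obtain ⟨A, hA, hup, hdown⟩ := hdiv σ hσ X hX
    have h2κ : 0 < 2 * κhi := by positivity
    refine ⟨fun z => A z / (2 * κhi), fun z => div_nonneg (hgnl _) h2κ.le, fun z => ?_, fun z => (hA z).div_const _,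
      fun M => ?_, fun M => ?_⟩
    · exact div_le_div_of_nonneg_left (hgnl _) (by linarith [hκpos (z, X z)]) (by linarith [hκhi (z, X z)])
    · obtain ⟨z, hz⟩ := hup (M * (2 * κhi))
      exact ⟨z, by rwa [lt_div_iff₀ h2κ]⟩
    · obtain ⟨z, hz⟩ := hdown (M * (2 * κhi))
      exact ⟨z, by rwa [div_lt_iff₀ h2κ]⟩
  -- derivative of `w` along a `σκ`-characteristic, and the John weight
  have halong : ∀ (σ : ℝ) (X : ℝ → ℝ), (∀ z, HasDerivAt X (σ * κ (w (z, X z))) z) → ∀ z,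
      HasDerivAt (fun t => Real.log (κ (w (t, X t))) / 2)
        (κ' (w (z, X z)) * (fderiv ℝ w (z, X z) (1, 0) + σ * κ (w (z, X z)) * fderiv ℝ w (z, X z) (0, 1)) /
          (2 * κ (w (z, X z)))) z := by
    intro σ X hX z
    have hwz := hasDerivAt_along (F := w) (hw1 (z, X z)) (hX z)
    have hκz := (hκd (w (z, X z))).comp z hwz
    have hκne : κ (w (z, X z)) ≠ 0 := (hκpos _).ne'
    have hlog := (hκz.log hκne).div_const 2
    refine hlog.congr_deriv ?_
    simp only [Function.comp_apply]
    field_simp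
  intro q
  obtain ⟨z₀, x₀⟩ := q
  -- r-family: speed `κ(w)`
  obtain ⟨X₁, hX₁0, hX₁⟩ := hchar 1 (Or.inl rfl) z₀ x₀
  have hX₁' : ∀ z, HasDerivAt X₁ (c₁ (z, X₁ z)) z := fun z => by simpa [hc₁] using hX₁ z
  obtain ⟨A₁, hã₁, hãa₁, hA₁, hup₁, hdown₁⟩ := hminor 1 (Or.inl rfl) X₁ hX₁
  have hr0 : ∀ z, fderiv ℝ r (z, X₁ z) (0, 1) = 0 := by
    refine transversal_eq_zero_of_split_divergent hr2 hc₁d hPDE1 hX₁'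
      (a := fun z => κ' (w (z, X₁ z)) / (2 * κ (w (z, X₁ z)))) hã₁ hãa₁
      (h := fun t => Real.log (κ (w (t, X₁ t))) / 2) (fun z => hlogbd _) (halong 1 X₁ hX₁) hA₁ hup₁ hdown₁ fun z => ?_
    rw [hc₁x, hrD, hsys2]
    have hκne : κ (w (z, X₁ z)) ≠ 0 := (hκpos _).ne'
    field_simp
    ring
  -- s-family: speed `-κ(w)`
  obtain ⟨X₂, hX₂0, hX₂⟩ := hchar (-1) (Or.inr rfl) z₀ x₀
  have hX₂' : ∀ z, HasDerivAt X₂ (c₂ (z, X₂ z)) z := fun z => by simpa [hc₂] using hX₂ z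
  obtain ⟨A₂, hã₂, hãa₂, hA₂, hup₂, hdown₂⟩ := hminor (-1) (Or.inr rfl) X₂ hX₂
  have hs0 : ∀ z, fderiv ℝ s (z, X₂ z) (0, 1) = 0 := by
    refine transversal_eq_zero_of_split_divergent hs2 hc₂d hPDE2 hX₂'
      (a := fun z => κ' (w (z, X₂ z)) / (2 * κ (w (z, X₂ z)))) hã₂ hãa₂
      (h := fun t => Real.log (κ (w (t, X₂ t))) / 2) (fun z => hlogbd _) (halong (-1) X₂ hX₂) hA₂ hup₂ hdown₂ fun z => ?_
    rw [hc₂x, hsD, hsys2]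
    have hκne : κ (w (z, X₂ z)) ≠ 0 := (hκpos _).ne'
    field_simp
    ring
  -- at the base point
  have h1 := hr0 z₀
  have h2 := hs0 z₀
  rw [hX₁0] at h1
  rw [hX₂0] at h2
  rw [hrD] at h1
  rw [hsD] at h2
  have hκne : κ (w (z₀, x₀)) ≠ 0 := (hκpos _).ne'
  have hwx : fderiv ℝ w (z₀, x₀) (0, 1) = 0 := by
    have : 2 * κ (w (z₀, x₀)) * fderiv ℝ w (z₀, x₀) (0, 1) = 0 := by linear_combination h1 - h2
    rcases mul_eq_zero.1 this with h | h
    · exact absurd h (mul_ne_zero two_ne_zero hκne)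
    · exact h
  have hpx : fderiv ℝ p (z₀, x₀) (0, 1) = 0 := by
    have : 2 * fderiv ℝ p (z₀, x₀) (0, 1) = 0 := by linear_combination h1 + h2
    linarith
  refine ⟨hwx, hpx, ?_, ?_⟩
  · rw [hsys2, hpx, neg_zero]
  · rw [hsys1, hwx, mul_zero, neg_zero]

/-- **★ R2, non-uniform form (constancy).**  Under the hypotheses of `pSystem_derivs_eq_zero_of_divergent` — in particular only
`κ'(w) ≥ 0` along the solution, plus two-sided divergence of `∫ κ'(w)` along every global characteristic — the two-sided eternal solution
`(w, p)` of the autonomous p-system is a CONSTANT STATE. [folklore] -/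
theorem pSystem_const_of_divergent {w p : ℝ × ℝ → ℝ} {κ κ' K : ℝ → ℝ} (hw : ContDiff ℝ 2 w) (hp : ContDiff ℝ 2 p)
    (hK2 : ContDiff ℝ 2 K) (hKd : ∀ v, HasDerivAt K (κ v) v) (hκd : ∀ v, HasDerivAt κ (κ' v) v)
    (hsys1 : ∀ q, fderiv ℝ p q (1, 0) = -(κ (w q) ^ 2 * fderiv ℝ w q (0, 1)))
    (hsys2 : ∀ q, fderiv ℝ w q (1, 0) = -fderiv ℝ p q (0, 1))
    {κlo κhi k₁ W₁ : ℝ} (hκlo0 : 0 < κlo) (hκlo : ∀ q, κlo ≤ κ (w q)) (hκhi : ∀ q, κ (w q) ≤ κhi)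
    (hgnl : ∀ q, 0 ≤ κ' (w q)) (hk₁ : ∀ q, |κ' (w q)| ≤ k₁) (hW₁ : ∀ q, |fderiv ℝ w q (0, 1)| ≤ W₁)
    (hdiv : ∀ σ : ℝ, (σ = 1 ∨ σ = -1) → ∀ X : ℝ → ℝ, (∀ z, HasDerivAt X (σ * κ (w (z, X z))) z) →
      ∃ A : ℝ → ℝ, (∀ z, HasDerivAt A (κ' (w (z, X z))) z) ∧ (∀ M : ℝ, ∃ z, M < A z) ∧ (∀ M : ℝ, ∃ z, A z < M)) :
    ∀ q q' : ℝ × ℝ, w q = w q' ∧ p q = p q' := by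
  have hall := pSystem_derivs_eq_zero_of_divergent hw hp hK2 hKd hκd hsys1 hsys2 hκlo0 hκlo hκhi hgnl hk₁ hW₁ hdiv
  have hw1 : Differentiable ℝ w := hw.differentiable (by simp)
  have hp1 : Differentiable ℝ p := hp.differentiable (by simp)
  have hDw : ∀ q, fderiv ℝ w q = 0 := fun q => by
    refine ContinuousLinearMap.ext fun v => ?_
    obtain ⟨a, b⟩ := v
    rw [Literature.Geometry.Riemannian.clm_prod_apply_eq, (hall q).1, (hall q).2.2.1]
    simp
  have hDp : ∀ q, fderiv ℝ p q = 0 := fun q => by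
    refine ContinuousLinearMap.ext fun v => ?_
    obtain ⟨a, b⟩ := v
    rw [Literature.Geometry.Riemannian.clm_prod_apply_eq, (hall q).2.1, (hall q).2.2.2]
    simp
  intro q q'
  exact ⟨is_const_of_fderiv_eq_zero hw1 hDw q q', is_const_of_fderiv_eq_zero hp1 hDp q q'⟩

end Summit.NavierStokesRegularity.NavierStokesRegularity.Theorems.PoloidalWindowDoorPoloidalWindowRigidityZShockPSystemLiouvilleDivergent

end
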